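import Summits.ValiantsHypothesis.ValiantsHypothesis.Theorems.GrenetZeonDualUnipotentThreeHalvesLongMassGaugeFormula

/-!
# GAUGE ROW for `GrenetZeon.DualUnipotentThreeHalves` (stmt-ValiantsHypothesis-24318), part 2/2 — the ROW `gaugePencil ℓ Ĉ`, its (c)-LEDGER at price `2n+1`, and the GAUGE MOVE

§4 THE ROW.  `gaugePencil ℓ Ĉ : AffMat n m := ℓ•J + [Ĉ,J]` for an affine form `ℓ` and an affine hook-supported `Ĉ` (any `n`, any `m ≥ 2`): `linCoeff`/`linForm`/
   `frozenDir` (the hyperplane of directions freezing `ℓ`, `finrank_frozenDir`: codim ≤ 1), `isAffine_gaugePencil`, `gaugePencil_pow_eq_zero` (`^m = 0`),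
   ★★ `ledger_gaugePencil : SlowCore.Ledger n m (gaugePencil ℓ Ĉ) (fun _ => True) (frozenDir ℓ) 2` — along `frozenDir ℓ` EVERY power has `s`-degree ≤ 2
   (§1 with `a = ℓ(x)` constant) — hence `relCert_gaugePencil : SlowCore.RelCert n m (gaugePencil ℓ Ĉ) (2*n+1)`, `slowR_gaugePencil : 3n+1 < n² → SlowR`,
   `slow_gaugePencil`, `slow_gaugePencil'` (via ✓ `SlowCore.slow_of_relCert`).
§5 `conj_pow_succ`, ★ `ledger_of_gauge` — the GAUGE MOVE as a certified ledger provider: if along every line of `K` the substituted pencil is `G·M·G'` with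
   `G'G = 1`, `deg G ≤ d₁`, `deg G' ≤ d₂` (POLYNOMIAL gauge) and the window powers of `M` have degree `≤ k₀`, then `Ledger N ⊤ K (d₁ + k₀ + d₂)`.
WHY a row of (c) (paper; val-idea-27 g7 MEMO-idea27-g7-weight-lens.md §1): on the irreducible constituents `W(b)` the constant-conjugation menu
(FREEZE/ABSORB/STACK/LEVEL/FLAG) fails to pay `c·√n·b` in the window `4c√n < b < 1.5·n^{5/6}/c` while the gauge certificate pays `2n+1`; (c) itself asks
for ∃ certificate and is NOT threatened.  Honest limits: no irreducibility proof here (paper, ENGINE-iota §3); the flag lower bound is paper.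

Status / honest framing (val-idea-27 g7's words, desk #377 WORDS OF RECORD): «the (c)-LEDGER exists at price 2n+1 on the GAUGE FAMILY (row r4,
hook-supported gauge pencils — the RelCert providers of V30); a SUPPORT LEMMA of the mass-cut line, never an `IrreducibleInv` constituent ⇒ NOT progress on
(c) `LongMassSlowLawInv` (RESEARCH — OPEN)».  This file asserts no law; everything is sorry-free kernel arithmetic about ONE family of pencils plus one
certified ledger move.  Crux 24318 / S3 `SlowPlane` / R2ᵖ / IRR / RED / (c) OPEN; 8062 OPEN; VP ≠ VNP is NOT proved.  Helper (`--supports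
stmt-ValiantsHypothesis-24318`).  Port (val-lit-p3 g18, desk #377 (G1) HAND 2) of val-idea-27 g7's `Cruxes/DualUnipotentThreeHalves/GaugeRow.lean` REV 2
(sha16 133a4a6739d5001d, 454 l., imports only ✓ `…SlowCoreLedger`, 0 sorry) — bodies VERBATIM by name, namespace `…Cruxes.DualUnipotentThreeHalves.GaugeRow`
→ `…Theorems.GrenetZeon.GaugeRow`, split in two files for the 400-line convention; critic of record val-idea-crit-7 g3; lead val-port-2 g3 (`slow_core` rev 2).
Credit: mathematics and kernel proofs val-idea-27 g7; cell data CENSUS-EXTREMISERS X4 / ENGINE-iota §3 (val-sym-eng-2); `Ledger`/`RelCert` vocabulary val-idea-26 g5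
(✓ `…SlowCoreLedger`, val-port-2 g3).  No instances, no notation, no named facts.
-/

-- single-conjunct layout: Sub = Summit, duplicated namespace component intended (the name is mandated)
set_option linter.dupNamespace false
set_option autoImplicit false

noncomputable section

namespace Summit.ValiantsHypothesis.ValiantsHypothesis.Theorems.GrenetZeon.GaugeRow

open MvPolynomial Matrix
open scoped BigOperators
open Summit.ValiantsHypothesis.ValiantsHypothesis.Cruxes.TwoDimCoefficients.DimTwoCases
  (AffMat IsAffine aeval_line_of_totalDegree_le_one totalDegree_aeval_line_le_one)
open Summit.ValiantsHypothesis.ValiantsHypothesis.Theorems.GrenetZeon.RadicalSplit (lineSubst FlagCheap pencilAlg)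
open Summit.ValiantsHypothesis.ValiantsHypothesis.Theorems.GrenetZeon.SlowCore (Slow SlowR slow_of_slowR Ledger RelCert slow_of_relCert)

variable {S T : Type*} {m : ℕ}

/-! ## §4 The row: `gaugePencil ℓ Ĉ` and its ledger along the hyperplane freezing `ℓ` -/

variable {n : ℕ}

/-- The coefficient of `s` in `ℓ(x + s v)` for an affine `ℓ`: `Σ_c v_c · [x_c]ℓ`. -/
def linCoeff (ℓ : MvPolynomial (Fin n × Fin n) ℂ) (v : Fin n × Fin n → ℂ) : ℂ :=
  ∑ c, v c * coeff (Finsupp.single c 1) ℓ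

/-- … as a linear form on directions. -/
def linForm (ℓ : MvPolynomial (Fin n × Fin n) ℂ) : (Fin n × Fin n → ℂ) →ₗ[ℂ] ℂ where
  toFun v := linCoeff ℓ v
  map_add' u w := by
    simp only [linCoeff, Pi.add_apply, add_mul, Finset.sum_add_distrib]
  map_smul' r u := by
    simp only [linCoeff, Pi.smul_apply, smul_eq_mul, RingHom.id_apply, Finset.mul_sum, mul_assoc]

/-- The direction hyperplane FREEZING `ℓ`. -/
def frozenDir (ℓ : MvPolynomial (Fin n × Fin n) ℂ) : Submodule ℂ (Fin n × Fin n → ℂ) := LinearMap.ker (linForm ℓ)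

/-- `codim (frozenDir ℓ) ≤ 1`. -/
theorem finrank_frozenDir (ℓ : MvPolynomial (Fin n × Fin n) ℂ) : n * n ≤ Module.finrank ℂ (frozenDir ℓ) + 1 := by
  have h := LinearMap.finrank_range_add_finrank_ker (linForm ℓ)
  have hr : Module.finrank ℂ (LinearMap.range (linForm ℓ)) ≤ 1 := by
    calc Module.finrank ℂ (LinearMap.range (linForm ℓ)) ≤ Module.finrank ℂ ℂ := Submodule.finrank_le _
      _ = 1 := Module.finrank_self ℂ
  have hV : Module.finrank ℂ (Fin n × Fin n → ℂ) = n * n := by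
    rw [Module.finrank_pi, Fintype.card_prod, Fintype.card_fin]
  rw [frozenDir]
  omega

/-- An affine polynomial along a line: `ℓ(x + s v) = ℓ(x) + linCoeff ℓ v · s`. -/
theorem lineSubst_of_affine (x v : Fin n × Fin n → ℂ) {g : MvPolynomial (Fin n × Fin n) ℂ} (hg : g.totalDegree ≤ 1) :
    lineSubst x v g = C (eval x g) + C (linCoeff g v) * X 0 := by
  rw [show lineSubst x v = aeval (fun c => (C (x c) + ∑ t : Fin (0 + 1), C ((fun _ : Fin (0 + 1) => v) t c) * X t :
      MvPolynomial (Fin (0 + 1)) ℂ)) from rfl, aeval_line_of_totalDegree_le_one x (fun _ : Fin (0 + 1) => v) hg]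
  simp only [Fin.sum_univ_succ, Fin.sum_univ_zero, add_zero, linCoeff]

/-- Along a frozen direction `ℓ(x + s v) = ℓ(x)` is a constant. -/
theorem lineSubst_of_frozen (x v : Fin n × Fin n → ℂ) {ℓ : MvPolynomial (Fin n × Fin n) ℂ} (hℓ : ℓ.totalDegree ≤ 1)
    (hv : v ∈ frozenDir ℓ) : lineSubst x v ℓ = C (eval x ℓ) := by
  have hz : linCoeff ℓ v = 0 := hv
  rw [lineSubst_of_affine x v hℓ, hz, C_0, zero_mul, add_zero]

/-- Affine entries stay affine along a line (Theorems-side twin). -/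
theorem totalDegree_lineSubst_le_one (x v : Fin n × Fin n → ℂ) {g : MvPolynomial (Fin n × Fin n) ℂ} (hg : g.totalDegree ≤ 1) :
    (lineSubst x v g).totalDegree ≤ 1 :=
  totalDegree_aeval_line_le_one x (fun _ : Fin (0 + 1) => v) hg

/-- **THE ROW.**  `gaugePencil ℓ Ĉ = ℓ•J_m + [Ĉ, J_m]` (eng-2's `W(m)`-pencils: `ℓ = x₀`, `Ĉ` = the generic matrix of `𝒳₁`). -/
def gaugePencil (ℓ : MvPolynomial (Fin n × Fin n) ℂ) (Ĉ : AffMat n m) : AffMat n m := gaugeMat ℓ Ĉ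

section DegreeBookkeeping

variable {σ : Type*}

/-- Entries of `J_m` are constants. [folklore] -/
theorem totalDegree_Jm_apply (i j : Fin m) : ((Jm m : Matrix (Fin m) (Fin m) (MvPolynomial σ ℂ)) i j).totalDegree = 0 := by
  simp only [Jm]
  split_ifs <;> simp

/-- Entries of `J_m^k` are constants. [folklore] -/
theorem totalDegree_Jm_pow_apply (k : ℕ) (i j : Fin m) :
    (((Jm m : Matrix (Fin m) (Fin m) (MvPolynomial σ ℂ)) ^ k) i j).totalDegree = 0 := by
  rw [← Jm_map (C : ℂ →+* MvPolynomial σ ℂ),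
    show (Jm m : Matrix (Fin m) (Fin m) ℂ).map (C : ℂ →+* MvPolynomial σ ℂ) = (C : ℂ →+* MvPolynomial σ ℂ).mapMatrix (Jm m) from rfl,
    ← map_pow]
  simp [RingHom.mapMatrix_apply, Matrix.map_apply]

/-- Entrywise total degree of a product of polynomial matrices. [folklore] -/
theorem totalDegree_mul_apply_le {M N : Matrix (Fin m) (Fin m) (MvPolynomial σ ℂ)} {d₁ d₂ : ℕ}
    (hM : ∀ i j, (M i j).totalDegree ≤ d₁) (hN : ∀ i j, (N i j).totalDegree ≤ d₂) (i j : Fin m) :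
    ((M * N) i j).totalDegree ≤ d₁ + d₂ := by
  rw [Matrix.mul_apply]
  refine (totalDegree_finsetSum _ _).trans (Finset.sup_le fun k _ => ?_)
  exact (totalDegree_mul _ _).trans (Nat.add_le_add (hM i k) (hN k j))

/-- Entrywise total degree of a sum. [folklore] -/
theorem totalDegree_add_apply_le {M N : Matrix (Fin m) (Fin m) (MvPolynomial σ ℂ)} {d : ℕ}
    (hM : ∀ i j, (M i j).totalDegree ≤ d) (hN : ∀ i j, (N i j).totalDegree ≤ d) (i j : Fin m) :
    ((M + N) i j).totalDegree ≤ d := by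
  rw [Matrix.add_apply]
  exact (totalDegree_add _ _).trans (max_le (hM i j) (hN i j))

/-- Entrywise total degree of a difference. [folklore] -/
theorem totalDegree_sub_apply_le {M N : Matrix (Fin m) (Fin m) (MvPolynomial σ ℂ)} {d : ℕ}
    (hM : ∀ i j, (M i j).totalDegree ≤ d) (hN : ∀ i j, (N i j).totalDegree ≤ d) (i j : Fin m) :
    ((M - N) i j).totalDegree ≤ d := by
  rw [Matrix.sub_apply]
  exact (totalDegree_sub _ _).trans (max_le (hM i j) (hN i j))

/-- Entrywise total degree of a scalar multiple. [folklore] -/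
theorem totalDegree_smul_apply_le {M : Matrix (Fin m) (Fin m) (MvPolynomial σ ℂ)} {a : MvPolynomial σ ℂ} {d₀ d : ℕ}
    (ha : a.totalDegree ≤ d₀) (hM : ∀ i j, (M i j).totalDegree ≤ d) (i j : Fin m) :
    ((a • M) i j).totalDegree ≤ d₀ + d := by
  rw [Matrix.smul_apply, smul_eq_mul]
  exact (totalDegree_mul _ _).trans (Nat.add_le_add ha (hM i j))

/-- Entries of `a•J + [C,J]` have degree `≤ max(deg a, deg C)`. -/
theorem totalDegree_gaugeMat_apply_le {a : MvPolynomial σ ℂ} {C' : Matrix (Fin m) (Fin m) (MvPolynomial σ ℂ)} {d : ℕ}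
    (ha : a.totalDegree ≤ d) (hC : ∀ i j, (C' i j).totalDegree ≤ d) (i j : Fin m) :
    ((gaugeMat a C') i j).totalDegree ≤ d := by
  have hJ : ∀ i j, ((Jm m : Matrix (Fin m) (Fin m) (MvPolynomial σ ℂ)) i j).totalDegree ≤ 0 :=
    fun i j => (totalDegree_Jm_apply i j).le
  unfold gaugeMat
  refine totalDegree_add_apply_le (d := d) ?_ ?_ i j
  · intro i j; simpa using totalDegree_smul_apply_le ha hJ i j
  · refine totalDegree_sub_apply_le ?_ ?_
    · intro i j; simpa using totalDegree_mul_apply_le hC hJ i j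
    · intro i j; simpa using totalDegree_mul_apply_le hJ hC i j

end DegreeBookkeeping

/-- `gaugePencil ℓ Ĉ` is an affine pencil. -/
theorem isAffine_gaugePencil {ℓ : MvPolynomial (Fin n × Fin n) ℂ} {Ĉ : AffMat n m} (hℓ : ℓ.totalDegree ≤ 1) (hĈ : IsAffine Ĉ) :
    IsAffine (gaugePencil ℓ Ĉ) :=
  fun i j => totalDegree_gaugeMat_apply_le hℓ hĈ i j

/-- `gaugePencil ℓ Ĉ` is nilpotent of index `≤ m` as a polynomial matrix (`m ≥ 2`). -/
theorem gaugePencil_pow_eq_zero (ℓ : MvPolynomial (Fin n × Fin n) ℂ) {Ĉ : AffMat n m} (hĈ : HookSupp Ĉ) (hm : 2 ≤ m) :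
    gaugePencil ℓ Ĉ ^ m = 0 :=
  gaugeMat_pow_eq_zero ℓ hĈ hm

/-- Line substitution commutes with the construction. -/
theorem gaugePencil_map_lineSubst (ℓ : MvPolynomial (Fin n × Fin n) ℂ) (Ĉ : AffMat n m) (x v : Fin n × Fin n → ℂ) :
    (gaugePencil ℓ Ĉ).map (lineSubst x v) = gaugeMat (lineSubst x v ℓ) (Ĉ.map (lineSubst x v)) :=
  gaugeMat_map (lineSubst x v).toRingHom ℓ Ĉ

-- rev 2: `Ledger` / `RelCert` are ✓ p680269 `Theorems.…SlowCoreLedger`'s `SlowCore.Ledger` / `SlowCore.RelCert` BY NAME (the δ-twins are gone).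

/-- ★★ **THE GAUGE CERTIFICATE of `W(m)`**: along the hyperplane of directions freezing `ℓ`, EVERY power of the substituted pencil has `s`-degree
`≤ 2` — at every point, including the boundary `ℓ(x) = 0` (no case split: §1 with the constant `a = ℓ(x)`). -/
theorem ledger_gaugePencil {ℓ : MvPolynomial (Fin n × Fin n) ℂ} {Ĉ : AffMat n m} (hℓ : ℓ.totalDegree ≤ 1) (hĈa : IsAffine Ĉ)
    (hĈ : HookSupp Ĉ) : Ledger n m (gaugePencil ℓ Ĉ) (fun _ => True) (frozenDir ℓ) 2 := by
  intro x v hv b _ i j _ _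
  rw [gaugePencil_map_lineSubst, lineSubst_of_frozen x v hℓ hv]
  set a : MvPolynomial (Fin 1) ℂ := C (eval x ℓ) with ha_def
  set C' : Matrix (Fin m) (Fin m) (MvPolynomial (Fin 1) ℂ) := Ĉ.map (lineSubst x v) with hC'_def
  have ha : a.totalDegree ≤ 0 := (totalDegree_C _).le
  have hC'1 : ∀ i j, (C' i j).totalDegree ≤ 1 := fun i j => by
    rw [hC'_def, Matrix.map_apply]; exact totalDegree_lineSubst_le_one x v (hĈa i j)
  have hC's : HookSupp C' := hĈ.map _ (map_zero _)
  have hJ0 : ∀ k (i j : Fin m), (((Jm m : Matrix (Fin m) (Fin m) (MvPolynomial (Fin 1) ℂ)) ^ k) i j).totalDegree ≤ 0 :=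
    fun k i j => (totalDegree_Jm_pow_apply k i j).le
  rcases Nat.lt_or_ge b 2 with hb | hb
  · interval_cases b
    · rw [pow_zero, Matrix.one_apply]
      split_ifs <;> simp
    · rw [pow_one]
      exact (totalDegree_gaugeMat_apply_le (d := 1) (ha.trans zero_le_one) hC'1 i j).trans one_le_two
  · obtain ⟨L, rfl⟩ : ∃ L, b = L + 2 := ⟨b - 2, by omega⟩
    rw [gaugeMat_pow a hC's L]
    have haL : (a ^ L).totalDegree ≤ 0 := (totalDegree_pow _ _).trans (by rw [ha_def, totalDegree_C, mul_zero])
    have ha2 : (a ^ 2).totalDegree ≤ 0 := (totalDegree_pow _ _).trans (by rw [ha_def, totalDegree_C, mul_zero])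
    set P := (Jm m : Matrix (Fin m) (Fin m) (MvPolynomial (Fin 1) ℂ)) ^ (L + 2) with hP
    have hP0 : ∀ i j, (P i j).totalDegree ≤ 0 := hJ0 (L + 2)
    -- degrees: a²•P : 0;  a•(C'P − PC') : 1;  C'PC' : 2
    have h1 : ∀ i j, ((a ^ 2 • P) i j).totalDegree ≤ 2 := fun i j =>
      (totalDegree_smul_apply_le ha2 hP0 i j).trans (by norm_num)
    have h2 : ∀ i j, ((a • (C' * P - P * C')) i j).totalDegree ≤ 2 := fun i j => by
      have hin : ∀ i j, ((C' * P - P * C') i j).totalDegree ≤ 1 :=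
        totalDegree_sub_apply_le (fun i j => by simpa using totalDegree_mul_apply_le hC'1 hP0 i j)
          (fun i j => by simpa using totalDegree_mul_apply_le hP0 hC'1 i j)
      exact (totalDegree_smul_apply_le ha hin i j).trans (by norm_num)
    have h3 : ∀ i j, ((C' * P * C') i j).totalDegree ≤ 2 := fun i j => by
      have := totalDegree_mul_apply_le (fun i j => totalDegree_mul_apply_le hC'1 hP0 i j) hC'1 i j
      simpa using this
    have h4 : ∀ i j, ((a ^ 2 • P + a • (C' * P - P * C') - C' * P * C') i j).totalDegree ≤ 2 :=
      totalDegree_sub_apply_le (totalDegree_add_apply_le h1 h2) h3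
    exact (totalDegree_smul_apply_le haL h4 i j).trans (by norm_num)

/-- **PRICE `2n + 1`** for every `W(m)`-type pencil (vs FREEZE `≈ b²/4`, ABSORB `n(b−1)`, FLAG `≥ min(1.5n^{4/3}, 2n²/b)` on `W(b)`). -/
theorem relCert_gaugePencil {ℓ : MvPolynomial (Fin n × Fin n) ℂ} {Ĉ : AffMat n m} (hℓ : ℓ.totalDegree ≤ 1) (hĈa : IsAffine Ĉ)
    (hĈ : HookSupp Ĉ) : RelCert n m (gaugePencil ℓ Ĉ) (2 * n + 1) := by
  refine ⟨frozenDir ℓ, 2, ledger_gaugePencil hℓ hĈa hĈ, ?_⟩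
  have := finrank_frozenDir ℓ
  omega

/-- In window currency: `W(m)`-type pencils are `SlowR` as soon as `3n + 1 < n²` (i.e. `n ≥ 4`), for EVERY format `m ≥ 2`. -/
theorem slowR_gaugePencil {ℓ : MvPolynomial (Fin n × Fin n) ℂ} {Ĉ : AffMat n m} (hℓ : ℓ.totalDegree ≤ 1) (hĈa : IsAffine Ĉ)
    (hĈ : HookSupp Ĉ) (hn : 3 * n + 1 < n * n) : SlowR n m (gaugePencil ℓ Ĉ) := by
  refine ⟨frozenDir ℓ, 2, fun x v hv b hb i j => ledger_gaugePencil hℓ hĈa hĈ x v hv b hb i j trivial trivial, ?_⟩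
  have := finrank_frozenDir ℓ
  omega

/-- The gauge pencil is `Slow` whenever `3n+1 < n²` (via `slowR`). [val-idea-27 g7] -/
theorem slow_gaugePencil {ℓ : MvPolynomial (Fin n × Fin n) ℂ} {Ĉ : AffMat n m} (hℓ : ℓ.totalDegree ≤ 1) (hĈa : IsAffine Ĉ)
    (hĈ : HookSupp Ĉ) (hn : 3 * n + 1 < n * n) : Slow n m (gaugePencil ℓ Ĉ) :=
  slow_of_slowR (slowR_gaugePencil hℓ hĈa hĈ hn)

/-- The same through the THEOREMS bridge ✓ `SlowCore.slow_of_relCert` (by-name sanity: r4's `RelCert` is the line's `RelCert`). -/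
theorem slow_gaugePencil' {ℓ : MvPolynomial (Fin n × Fin n) ℂ} {Ĉ : AffMat n m} (hℓ : ℓ.totalDegree ≤ 1) (hĈa : IsAffine Ĉ)
    (hĈ : HookSupp Ĉ) (hn : 3 * n + 1 < n * n) : Slow n m (gaugePencil ℓ Ĉ) :=
  slow_of_relCert (relCert_gaugePencil hℓ hĈa hĈ) (by omega)

/-! ## §5 The GAUGE MOVE as a certified ledger provider (the primitive missing from FREEZE · ABSORB · STACK · LEVEL · FLAG) -/

/-- Powers of a polynomial-gauge conjugate: `G'G = 1 ⇒ (G M G')^b = G M^b G'` for `b ≥ 1`; with `b = 0` both sides differ (`1` vs `GG'`), so the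
move below treats `b = 0` separately. [folklore] -/
theorem conj_pow_succ {R : Type*} [Semiring R] (G G' M : Matrix (Fin m) (Fin m) R) (hGG : G' * G = 1) :
    ∀ b : ℕ, (G * M * G') ^ (b + 1) = G * M ^ (b + 1) * G' := by
  intro b
  induction b with
  | zero => rw [zero_add, pow_one, pow_one]
  | succ b ih =>
      rw [pow_succ, ih]
      calc G * M ^ (b + 1) * G' * (G * M * G') = G * M ^ (b + 1) * (G' * G) * M * G' := by
            simp only [Matrix.mul_assoc]
        _ = G * M ^ (b + 1 + 1) * G' := by rw [hGG, Matrix.mul_one, pow_succ M (b + 1)]; simp only [Matrix.mul_assoc]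

/-- ★ **GAUGE MOVE.**  If along every line of `K` the substituted pencil is `G · M · G'` with `G'G = 1`, `deg G ≤ d₁`, `deg G' ≤ d₂` (an
`s`-POLYNOMIAL gauge) and the window powers of `M` have `s`-degree `≤ k₀`, then the pencil has ledger `d₁ + k₀ + d₂` on `K`.  (`W(m)` at a point with
`ℓ(x) ≠ 0`: `G = 1 + C'_s/ℓ(x)`, `G' = 1 − C'_s/ℓ(x)`, `M = ℓ(x)·J` constant, `(d₁, k₀, d₂) = (1, 0, 1)`.)  Every move of `MassCut.lean` §1–§2 and
`slowR_of_flagCheap` conjugates by CONSTANT matrices (`d₁ = d₂ = 0`). [val-idea-27 g7] -/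
theorem ledger_of_gauge (N : AffMat n m) (K : Submodule ℂ (Fin n × Fin n → ℂ)) (d₁ k₀ d₂ : ℕ)
    (h : ∀ x v : Fin n × Fin n → ℂ, v ∈ K →
      ∃ G G' M : Matrix (Fin m) (Fin m) (MvPolynomial (Fin 1) ℂ),
        G' * G = 1 ∧ N.map (lineSubst x v) = G * M * G' ∧
        (∀ i j, (G i j).totalDegree ≤ d₁) ∧ (∀ i j, (G' i j).totalDegree ≤ d₂) ∧
        (∀ b, b ≤ n - 1 → ∀ i j, ((M ^ b) i j).totalDegree ≤ k₀)) :
    Ledger n m N (fun _ => True) K (d₁ + k₀ + d₂) := by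
  intro x v hv b hb i j _ _
  obtain ⟨G, G', M, hGG, hN, hG, hG', hM⟩ := h x v hv
  rcases Nat.eq_zero_or_pos b with rfl | hpos
  · rw [pow_zero, Matrix.one_apply]
    split_ifs <;> simp
  · obtain ⟨b, rfl⟩ : ∃ b', b = b' + 1 := ⟨b - 1, by omega⟩
    rw [hN, conj_pow_succ G G' M hGG b]
    exact totalDegree_mul_apply_le (totalDegree_mul_apply_le hG (hM (b + 1) hb)) hG' i j

end Summit.ValiantsHypothesis.ValiantsHypothesis.Theorems.GrenetZeon.GaugeRow

end
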